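import Summits.Parity.GeneralizedHardyLittlewood.Theorems.HomothetyPencilDictionary

/-!
# HomothetyPencil — necessity, sufficiency-beneath-the-leaves and the cone (part 2 of 2)
(Theorems-grade port of the decomp-parity lens-4 g7 kernel onto the BORN items of
`route-Parity-HomothetyPencil`; crit-1 CLEARED HOME/STATUS.md l.436, CRITIC-LEDGER row 81, hand lane P5;
hand HOME/decomp-parity-lens-4/g7/hand/HomothetyPencilNecessity.lean sha16 c19c2ffa5133a7f4, ENDORSED l.463;
part 1 = `HomothetyPencilDictionary.lean`)

Main results (all hypothesis-free unless the record context `Q, UU, UL` is named):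
* `pencilHL_of_ghl : GeneralizedHardyLittlewood → PencilHL`, `pencilRigidity_of_ghl` (necessity; kill path
  `not_ghl_of_not_pencilHL`);
* `fixed_of_pencil_items : PencilHL → PencilRigidity → FixedUpper ∧ FixedLower` (the averaging-free
  extremal step: `1 ∈ pencil`, two exceptional sets of density ≤ 1/4 cannot cover the pencil);
* `node_iff_items : Q → UU → UL → ((FixedUpper ∧ FixedLower) ↔ (PencilHL ∧ PencilRigidity))`;
* θ-generic necessity `pencilHLAt_of_ghl`, `pencilRigidityAt_of_ghl` (`θ ≤ 1`) and `closes_via_kernel`.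
-/

namespace Summit.Parity.GeneralizedHardyLittlewood.Theses.HomothetyPencil

open Finset
open Literature.NumberTheory.Sieve hiding GeneralizedHardyLittlewood

noncomputable section

/-! ## §3 Sufficiency: the pencil pieces give two-sided fixed-pattern HL (θ-free counting) -/

/-- **Averaging-free extremal step.**  `1 ∈ pencil`; two exceptional sets of density `≤ 1/4` cannot
cover the pencil; at a doubly-good dilation `q`: `|E(Ψ)| ≤ |E(q·Ψ)| + |E(q·Ψ) − E(Ψ)| ≤ 2δN^d`. -/
theorem fixedHL_of_pencil {θ : ℝ} (hP : (∀ (d t L : ℕ), 1 ≤ d → 1 ≤ t → ∀ ε : ℝ, 0 < ε → ∃ N₀ : ℕ, ∀ N : ℕ, N₀ ≤ N → ∀ Ψ : Fin t → AffLinForm d, IsNondegenerateSystem Ψ → affLinSize Ψ 1 ≤ L → ∀ K : Set (Fin d → ℝ), Convex ℝ K → K ⊆ realBox d N → ∃ B : Finset ℕ, B ⊆ pencil θ (strideMod t L) N ∧ (B.card : ℝ) ≤ ε * ((pencil θ (strideMod t L) N).card : ℝ) ∧ ∀ q ∈ pencil θ (strideMod t L) N, q ∉ B → |hlError (dilate q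 Ψ) K N| ≤ ε * (N : ℝ) ^ d)) (hR : (∀ (d t L : ℕ), 1 ≤ d → 1 ≤ t → ∀ ε : ℝ, 0 < ε → ∃ N₀ : ℕ, ∀ N : ℕ, N₀ ≤ N → ∀ Ψ : Fin t → AffLinForm d, IsNondegenerateSystem Ψ → affLinSize Ψ 1 ≤ L → ∀ K : Set (Fin d → ℝ), Convex ℝ K → K ⊆ realBox d N → ∃ E : Finset ℕ, E ⊆ pencil θ (strideMod t L) N ∧ (E.card : ℝ) ≤ ε * ((pencil θ (strideMod t L) N).card : ℝ) ∧ ∀ q ∈ pencil θ (strideMod t L) N, q ∉ E → |hlError (dilate q Ψ) K N - hlError Ψ K N| ≤ ε * (N : ℝ) ^ d)) : (∀ (d t : ℕ), 1 ≤ d → 1 ≤ t → ∀ Ψ : Fin t → AffLinForm d, IsNondegenerateSystem Ψ → ∀ ε : ℝ, 0 < ε → ∃ N₀ : ℕ, ∀ N : ℕ, N₀ ≤ N → ∀ K : Set (Fin d → ℝ), Convex ℝ K → K ⊆ realBox d N → |hlError Ψ K N| ≤ ε * (N : ℝ) ^ d) := by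
  intro d t hd ht Ψ hΨ ε hε
  set L : ℕ := ⌈affLinSize Ψ 1⌉₊ with hLdef
  have hL : affLinSize Ψ 1 ≤ (L : ℝ) := Nat.le_ceil _
  set δ : ℝ := min (ε / 2) (1 / 4) with hδ
  have hδpos : 0 < δ := lt_min (by positivity) (by norm_num)
  have hδε : δ ≤ ε / 2 := min_le_left _ _
  have hδ4 : δ ≤ 1 / 4 := min_le_right _ _
  obtain ⟨N₁, h₁⟩ := hP d t L hd ht δ hδpos
  obtain ⟨N₂, h₂⟩ := hR d t L hd ht δ hδpos
  refine ⟨max N₁ N₂, fun N hN K hK hKN => ?_⟩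
  obtain ⟨B, -, hBcard, hBgood⟩ := h₁ N (le_trans (le_max_left _ _) hN) Ψ hΨ hL K hK hKN
  obtain ⟨E, -, hEcard, hEgood⟩ := h₂ N (le_trans (le_max_right _ _) hN) Ψ hΨ hL K hK hKN
  have hGpos : (0 : ℝ) < ((pencil θ (strideMod t L) N).card : ℝ) := by
    exact_mod_cast pencil_card_pos
  have hlt : ((B ∪ E).card : ℝ) < ((pencil θ (strideMod t L) N).card : ℝ) := by
    have hu : ((B ∪ E).card : ℝ) ≤ B.card + E.card := by exact_mod_cast Finset.card_union_le B E
    have hB' : (B.card : ℝ) ≤ 1 / 4 * (pencil θ (strideMod t L) N).card :=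
      hBcard.trans (mul_le_mul_of_nonneg_right hδ4 hGpos.le)
    have hE' : (E.card : ℝ) ≤ 1 / 4 * (pencil θ (strideMod t L) N).card :=
      hEcard.trans (mul_le_mul_of_nonneg_right hδ4 hGpos.le)
    linarith
  obtain ⟨q, hqG, hqBE⟩ : ∃ q ∈ pencil θ (strideMod t L) N, q ∉ B ∪ E := by
    by_contra hcon
    push Not at hcon
    have hsub : pencil θ (strideMod t L) N ⊆ B ∪ E := fun q hq => hcon q hq
    have h' : ((pencil θ (strideMod t L) N).card : ℝ) ≤ (B ∪ E).card := by
      exact_mod_cast Finset.card_le_card hsub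
    linarith
  have hqB : q ∉ B := fun h => hqBE (Finset.mem_union_left E h)
  have hqE : q ∉ E := fun h => hqBE (Finset.mem_union_right B h)
  have e1 : |hlError (dilate q Ψ) K N| ≤ δ * (N : ℝ) ^ d := hBgood q hqG hqB
  have e2 : |hlError (dilate q Ψ) K N - hlError Ψ K N| ≤ δ * (N : ℝ) ^ d := hEgood q hqG hqE
  have hNd : (0 : ℝ) ≤ (N : ℝ) ^ d := by positivity
  have e3 := abs_sub_abs_le_abs_sub (hlError Ψ K N) (hlError (dilate q Ψ) K N)
  rw [abs_sub_comm (hlError Ψ K N)] at e3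
  have hδN : δ * (N : ℝ) ^ d ≤ ε / 2 * (N : ℝ) ^ d := mul_le_mul_of_nonneg_right hδε hNd
  linarith

/-- Contrapositive = the lens reading: a counterexample to fixed-pattern HL refutes one of the two
pencil pieces (it is pencil-isolated, or HL fails along a proportion of its pencil). -/
theorem counterexample_dichotomy {θ : ℝ} (h : ¬ (∀ (d t : ℕ), 1 ≤ d → 1 ≤ t → ∀ Ψ : Fin t → AffLinForm d, IsNondegenerateSystem Ψ → ∀ ε : ℝ, 0 < ε → ∃ N₀ : ℕ, ∀ N : ℕ, N₀ ≤ N → ∀ K : Set (Fin d → ℝ), Convex ℝ K → K ⊆ realBox d N → |hlError Ψ K N| ≤ ε * (N : ℝ) ^ d)) : ¬ (∀ (d t L : ℕ), 1 ≤ d → 1 ≤ t → ∀ ε : ℝ, 0 < ε → ∃ N₀ : ℕ, ∀ N : ℕ, N₀ ≤ N → ∀ Ψ : Fin t → AffLinForm d, IsNondegenerateSystem Ψ → affLinSize Ψ 1 ≤ L → ∀ K : Set (Fin d → ℝ), Convex ℝ K → K ⊆ realBox d N → ∃ B : Finset ℕ, B ⊆ pencil θ (strideMod t L) N ∧ (B.card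 : ℝ) ≤ ε * ((pencil θ (strideMod t L) N).card : ℝ) ∧ ∀ q ∈ pencil θ (strideMod t L) N, q ∉ B → |hlError (dilate q Ψ) K N| ≤ ε * (N : ℝ) ^ d) ∨ ¬ (∀ (d t L : ℕ), 1 ≤ d → 1 ≤ t → ∀ ε : ℝ, 0 < ε → ∃ N₀ : ℕ, ∀ N : ℕ, N₀ ≤ N → ∀ Ψ : Fin t → AffLinForm d, IsNondegenerateSystem Ψ → affLinSize Ψ 1 ≤ L → ∀ K : Set (Fin d → ℝ), Convex ℝ K → K ⊆ realBox d N → ∃ E : Finset ℕ, E ⊆ pencil θ (strideMod t L) N ∧ (E.card : ℝ) ≤ ε * ((pencil θ (strideMod t L) N).card : ℝ) ∧ ∀ q ∈ pencil θ (strideMod t L) N, q ∉ E → |hlError (dilate q Ψ) K N - hlError Ψ K N| ≤ ε * (N : ℝ) ^ d) := by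
  by_contra hcon
  push Not at hcon
  exact h (fixedHL_of_pencil hcon.1 hcon.2)

/-- `FixedHL` is exactly the conjunction of the record leaves `FU ∧ FL`. -/
theorem fixedHL_iff :
    (∀ (d t : ℕ), 1 ≤ d → 1 ≤ t → ∀ Ψ : Fin t → AffLinForm d, IsNondegenerateSystem Ψ → ∀ ε : ℝ, 0 < ε → ∃ N₀ : ℕ, ∀ N : ℕ, N₀ ≤ N → ∀ K : Set (Fin d → ℝ), Convex ℝ K → K ⊆ realBox d N → |hlError Ψ K N| ≤ ε * (N : ℝ) ^ d) ↔ (SiegelSpectrumSplit.FixedUpper ∧ SiegelSpectrumSplit.FixedLower) := by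
  constructor
  · intro h
    refine ⟨fun d t hd ht Ψ hΨ ε hε => ?_, fun d t hd ht Ψ hΨ ε hε => ?_⟩
    · obtain ⟨N₀, hN₀⟩ := h d t hd ht Ψ hΨ ε hε
      exact ⟨N₀, fun N hN K hK hKN => (le_abs_self _).trans (hN₀ N hN K hK hKN)⟩
    · obtain ⟨N₀, hN₀⟩ := h d t hd ht Ψ hΨ ε hε
      refine ⟨N₀, fun N hN K hK hKN => ?_⟩
      have h' := hN₀ N hN K hK hKN
      unfold hlError at h'
      rw [abs_sub_comm] at h'
      exact (le_abs_self _).trans h'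
  · rintro ⟨hU, hL⟩ d t hd ht Ψ hΨ ε hε
    obtain ⟨N₁, h₁⟩ := hU d t hd ht Ψ hΨ ε hε
    obtain ⟨N₂, h₂⟩ := hL d t hd ht Ψ hΨ ε hε
    refine ⟨max N₁ N₂, fun N hN K hK hKN => abs_sub_le_iff.mpr ⟨?_, ?_⟩⟩
    · exact h₁ N (le_trans (le_max_left _ _) hN) K hK hKN
    · exact h₂ N (le_trans (le_max_right _ _) hN) K hK hKN

/-- Hypothesis-free half of the node: the two pencil pieces give BOTH fixed-pattern leaves. -/
theorem fixed_of_pencil {θ : ℝ} (hP : (∀ (d t L : ℕ), 1 ≤ d → 1 ≤ t → ∀ ε : ℝ, 0 < ε → ∃ N₀ : ℕ, ∀ N : ℕ, N₀ ≤ N → ∀ Ψ : Fin t → AffLinForm d, IsNondegenerateSystem Ψ → affLinSize Ψ 1 ≤ L → ∀ K : Set (Fin d → ℝ), Convex ℝ K → K ⊆ realBox d N → ∃ B : Finset ℕ, B ⊆ pencil θ (strideMod t L) N ∧ (B.card : ℝ) ≤ ε * ((pencil θ (strideMod t L) N).card : ℝ) ∧ ∀ q ∈ pencil θ (strideMod t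 L) N, q ∉ B → |hlError (dilate q Ψ) K N| ≤ ε * (N : ℝ) ^ d)) (hR : (∀ (d t L : ℕ), 1 ≤ d → 1 ≤ t → ∀ ε : ℝ, 0 < ε → ∃ N₀ : ℕ, ∀ N : ℕ, N₀ ≤ N → ∀ Ψ : Fin t → AffLinForm d, IsNondegenerateSystem Ψ → affLinSize Ψ 1 ≤ L → ∀ K : Set (Fin d → ℝ), Convex ℝ K → K ⊆ realBox d N → ∃ E : Finset ℕ, E ⊆ pencil θ (strideMod t L) N ∧ (E.card : ℝ) ≤ ε * ((pencil θ (strideMod t L) N).card : ℝ) ∧ ∀ q ∈ pencil θ (strideMod t L) N, q ∉ E → |hlError (dilate q Ψ) K N - hlError Ψ K N| ≤ ε * (N : ℝ) ^ d)) :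
    SiegelSpectrumSplit.FixedUpper ∧ SiegelSpectrumSplit.FixedLower :=
  fixedHL_iff.mp (fixedHL_of_pencil hP hR)

/-! ## §4 The record context: `Q, UU, UL` carry fixed patterns to GHL (route-Parity-SiegelSpectrumSplit) -/

/-- Record glue: `Q → UU → UL → (∀ (d t : ℕ), 1 ≤ d → 1 ≤ t → ∀ Ψ : Fin t → AffLinForm d, IsNondegenerateSystem Ψ → ∀ ε : ℝ, 0 < ε → ∃ N₀ : ℕ, ∀ N : ℕ, N₀ ≤ N → ∀ K : Set (Fin d → ℝ), Convex ℝ K → K ⊆ realBox d N → |hlError Ψ K N| ≤ ε * (N : ℝ) ^ d) → GHL` (the uniformity lifts are the record's residuals). -/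
theorem ghl_of_record (hQ : SiegelSpectrumSplit.BoundedSiegelZeroQuality)
    (hUU : SiegelSpectrumSplit.UniformUpperGivenFixed)
    (hUL : SiegelSpectrumSplit.UniformLowerGivenFixed) (hF : (∀ (d t : ℕ), 1 ≤ d → 1 ≤ t → ∀ Ψ : Fin t → AffLinForm d, IsNondegenerateSystem Ψ → ∀ ε : ℝ, 0 < ε → ∃ N₀ : ℕ, ∀ N : ℕ, N₀ ≤ N → ∀ K : Set (Fin d → ℝ), Convex ℝ K → K ⊆ realBox d N → |hlError Ψ K N| ≤ ε * (N : ℝ) ^ d)) :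
    GeneralizedHardyLittlewood := by
  obtain ⟨hFU, hFL⟩ := fixedHL_iff.mp hF
  intro d t L hd ht ε hε
  obtain ⟨N₁, h₁⟩ := hUU hQ hFU d t L hd ht ε hε
  obtain ⟨N₂, h₂⟩ := hUL hQ hFL d t L hd ht ε hε
  refine ⟨max N₁ N₂, fun N hN Ψ hΨ hΨL K hK hKN => abs_sub_le_iff.mpr ⟨?_, ?_⟩⟩
  · exact h₁ N (le_trans (le_max_left _ _) hN) Ψ hΨ hΨL K hK hKN
  · exact h₂ N (le_trans (le_max_right _ _) hN) Ψ hΨ hΨL K hK hKN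

/-! ## §5 Necessity: both pieces are consequences of GHL (empty exceptional sets) -/

/-- `GHL ⟹` two-sided fixed-pattern HL (the `L := affLinSize Ψ 1` instance of the statement). -/
theorem fixedHL_of_ghl (h : GeneralizedHardyLittlewood) : (∀ (d t : ℕ), 1 ≤ d → 1 ≤ t → ∀ Ψ : Fin t → AffLinForm d, IsNondegenerateSystem Ψ → ∀ ε : ℝ, 0 < ε → ∃ N₀ : ℕ, ∀ N : ℕ, N₀ ≤ N → ∀ K : Set (Fin d → ℝ), Convex ℝ K → K ⊆ realBox d N → |hlError Ψ K N| ≤ ε * (N : ℝ) ^ d) := by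
  intro d t hd ht Ψ hΨ ε hε
  obtain ⟨N₀, hN₀⟩ := h d t ⌈affLinSize Ψ 1⌉₊ hd ht ε hε
  refine ⟨max N₀ 1, fun N hN K hK hKN => hN₀ N (le_trans (le_max_left _ _) hN) Ψ hΨ ?_ K hK hKN⟩
  exact (affLinSize_le_affLinSize_one Ψ (le_trans (le_max_right _ _) hN)).trans (Nat.le_ceil _)

/-- `GHL ⟹ PencilHL(θ)` for `θ ≤ 1` (take `B = ∅`; `‖q·Ψ‖_N ≤ 2L`). -/
theorem pencilHLAt_of_ghl {θ : ℝ} (hθ₁ : θ ≤ 1) (h : GeneralizedHardyLittlewood) : (∀ (d t L : ℕ), 1 ≤ d → 1 ≤ t → ∀ ε : ℝ, 0 < ε → ∃ N₀ : ℕ, ∀ N : ℕ, N₀ ≤ N → ∀ Ψ : Fin t → AffLinForm d, IsNondegenerateSystem Ψ → affLinSize Ψ 1 ≤ L → ∀ K : Set (Fin d → ℝ), Convex ℝ K → K ⊆ realBox d N → ∃ B : Finset ℕ, B ⊆ pencil θ (strideMod t L) N ∧ (B.card : ℝ) ≤ ε * ((pencil θ (strideMod t L) N).card : ℝ) ∧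 ∀ q ∈ pencil θ (strideMod t L) N, q ∉ B → |hlError (dilate q Ψ) K N| ≤ ε * (N : ℝ) ^ d) := by
  intro d t L hd ht ε hε
  obtain ⟨N₀, hN₀⟩ := h d t (2 * L) hd ht ε hε
  refine ⟨max N₀ 1, fun N hN Ψ hΨ hL K hK hKN => ⟨∅, Finset.empty_subset _, ?_, fun q hq _ => ?_⟩⟩
  · rw [Finset.card_empty, Nat.cast_zero]
    positivity
  · have hN0 : N₀ ≤ N := le_trans (le_max_left _ _) hN
    have hN1 : 1 ≤ N := le_trans (le_max_right _ _) hN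
    obtain ⟨hq1, hq2⟩ := pencil_bounds hθ₁ hN1 hq
    have hnd := isNondegenerateSystem_dilate hΨ (by omega : q ≠ 0)
    have hsz : affLinSize (dilate q Ψ) N ≤ ((2 * L : ℕ) : ℝ) := by
      have h' := affLinSize_dilate_le Ψ (by omega : 0 < N) hq2
      push_cast
      linarith
    exact hN₀ N hN0 _ hnd hsz K hK hKN

/-- `GHL ⟹ PencilRigidity(θ)` for `θ ≤ 1` (take `E = ∅`; triangle inequality). -/
theorem pencilRigidityAt_of_ghl {θ : ℝ} (hθ₁ : θ ≤ 1) (h : GeneralizedHardyLittlewood) :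
    (∀ (d t L : ℕ), 1 ≤ d → 1 ≤ t → ∀ ε : ℝ, 0 < ε → ∃ N₀ : ℕ, ∀ N : ℕ, N₀ ≤ N → ∀ Ψ : Fin t → AffLinForm d, IsNondegenerateSystem Ψ → affLinSize Ψ 1 ≤ L → ∀ K : Set (Fin d → ℝ), Convex ℝ K → K ⊆ realBox d N → ∃ E : Finset ℕ, E ⊆ pencil θ (strideMod t L) N ∧ (E.card : ℝ) ≤ ε * ((pencil θ (strideMod t L) N).card : ℝ) ∧ ∀ q ∈ pencil θ (strideMod t L) N, q ∉ E → |hlError (dilate q Ψ) K N - hlError Ψ K N| ≤ ε * (N : ℝ) ^ d) := by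
  intro d t L hd ht ε hε
  obtain ⟨N₀, hN₀⟩ := h d t (2 * L) hd ht (ε / 2) (by positivity)
  refine ⟨max N₀ 1, fun N hN Ψ hΨ hL K hK hKN => ⟨∅, Finset.empty_subset _, ?_, fun q hq _ => ?_⟩⟩
  · rw [Finset.card_empty, Nat.cast_zero]
    positivity
  · have hN0 : N₀ ≤ N := le_trans (le_max_left _ _) hN
    have hN1 : 1 ≤ N := le_trans (le_max_right _ _) hN
    obtain ⟨hq1, hq2⟩ := pencil_bounds hθ₁ hN1 hq
    have hnd := isNondegenerateSystem_dilate hΨ (by omega : q ≠ 0)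
    have hsz : affLinSize (dilate q Ψ) N ≤ ((2 * L : ℕ) : ℝ) := by
      have h' := affLinSize_dilate_le Ψ (by omega : 0 < N) hq2
      push_cast
      linarith
    have hsz1 : affLinSize Ψ N ≤ ((2 * L : ℕ) : ℝ) := by
      have h' := affLinSize_le_affLinSize_one Ψ hN1
      have h'' : (0 : ℝ) ≤ L := Nat.cast_nonneg L
      push_cast
      linarith
    have e1 : |hlError (dilate q Ψ) K N| ≤ ε / 2 * (N : ℝ) ^ d := hN₀ N hN0 _ hnd hsz K hK hKN
    have e2 : |hlError Ψ K N| ≤ ε / 2 * (N : ℝ) ^ d := hN₀ N hN0 Ψ hΨ hsz1 K hK hKN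
    calc |hlError (dilate q Ψ) K N - hlError Ψ K N|
        ≤ |hlError (dilate q Ψ) K N| + |hlError Ψ K N| := by
          simpa [sub_eq_add_neg, abs_neg] using
            abs_add_le (hlError (dilate q Ψ) K N) (-hlError Ψ K N)
      _ ≤ ε / 2 * (N : ℝ) ^ d + ε / 2 * (N : ℝ) ^ d := add_le_add e1 e2
      _ = ε * (N : ℝ) ^ d := by ring

/-- **Node exactness (given the record context).**  `Q → UU → UL →  ((FU ∧ FL) ↔ (PencilHL(θ) ∧ PencilRigidity(θ)))`
for every `θ ≤ 1`; the `←` direction uses no hypothesis (`fixed_of_pencil`). -/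
theorem node_iff {θ : ℝ} (hθ₁ : θ ≤ 1) (hQ : SiegelSpectrumSplit.BoundedSiegelZeroQuality)
    (hUU : SiegelSpectrumSplit.UniformUpperGivenFixed)
    (hUL : SiegelSpectrumSplit.UniformLowerGivenFixed) :
    (SiegelSpectrumSplit.FixedUpper ∧ SiegelSpectrumSplit.FixedLower) ↔
      ((∀ (d t L : ℕ), 1 ≤ d → 1 ≤ t → ∀ ε : ℝ, 0 < ε → ∃ N₀ : ℕ, ∀ N : ℕ, N₀ ≤ N → ∀ Ψ : Fin t → AffLinForm d, IsNondegenerateSystem Ψ → affLinSize Ψ 1 ≤ L → ∀ K : Set (Fin d → ℝ), Convex ℝ K → K ⊆ realBox d N → ∃ B : Finset ℕ, B ⊆ pencil θ (strideMod t L) N ∧ (B.card : ℝ) ≤ ε * ((pencil θ (strideMod t L) N).card : ℝ) ∧ ∀ q ∈ pencil θ (strideMod t L) N, q ∉ B → |hlError (dilate q Ψ) K N| ≤ ε * (N : ℝ) ^ d) ∧ (∀ (d t L : ℕ), 1 ≤ d → 1 ≤ t → ∀ ε : ℝ, 0 < ε → ∃ N₀ : ℕ, ∀ N : ℕ, N₀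 ≤ N → ∀ Ψ : Fin t → AffLinForm d, IsNondegenerateSystem Ψ → affLinSize Ψ 1 ≤ L → ∀ K : Set (Fin d → ℝ), Convex ℝ K → K ⊆ realBox d N → ∃ E : Finset ℕ, E ⊆ pencil θ (strideMod t L) N ∧ (E.card : ℝ) ≤ ε * ((pencil θ (strideMod t L) N).card : ℝ) ∧ ∀ q ∈ pencil θ (strideMod t L) N, q ∉ E → |hlError (dilate q Ψ) K N - hlError Ψ K N| ≤ ε * (N : ℝ) ^ d)) :=
  ⟨fun h =>
    have hG := ghl_of_record hQ hUU hUL (fixedHL_iff.mpr h)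
    ⟨pencilHLAt_of_ghl hθ₁ hG, pencilRigidityAt_of_ghl hθ₁ hG⟩,
   fun h => fixed_of_pencil h.1 h.2⟩

/-- Hypothesis-free exactness against the summit conjunct: `GHL ↔ (∀ (d t : ℕ), 1 ≤ d → 1 ≤ t → ∀ Ψ : Fin t → AffLinForm d, IsNondegenerateSystem Ψ → ∀ ε : ℝ, 0 < ε → ∃ N₀ : ℕ, ∀ N : ℕ, N₀ ≤ N → ∀ K : Set (Fin d → ℝ), Convex ℝ K → K ⊆ realBox d N → |hlError Ψ K N| ≤ ε * (N : ℝ) ^ d) ∧ ((∀ (d t : ℕ), 1 ≤ d → 1 ≤ t → ∀ Ψ : Fin t → AffLinForm d, IsNondegenerateSystem Ψ → ∀ ε : ℝ, 0 < ε → ∃ N₀ : ℕ, ∀ N : ℕ, N₀ ≤ N → ∀ K : Set (Fin d → ℝ), Convex ℝ K → K ⊆ realBox d N → |hlError Ψ K N| ≤ ε * (N : ℝ) ^ d) → GHL)` is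
trivial, but `GHL → PencilHL(θ) ∧ PencilRigidity(θ) → (∀ (d t : ℕ), 1 ≤ d → 1 ≤ t → ∀ Ψ : Fin t → AffLinForm d, IsNondegenerateSystem Ψ → ∀ ε : ℝ, 0 < ε → ∃ N₀ : ℕ, ∀ N : ℕ, N₀ ≤ N → ∀ K : Set (Fin d → ℝ), Convex ℝ K → K ⊆ realBox d N → |hlError Ψ K N| ≤ ε * (N : ℝ) ^ d)` is the content: both pieces are
NECESSARY for GHL and jointly SUFFICIENT for the fixed-pattern leaves. -/
theorem pieces_of_ghl {θ : ℝ} (hθ₁ : θ ≤ 1) (h : GeneralizedHardyLittlewood) :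
    (∀ (d t L : ℕ), 1 ≤ d → 1 ≤ t → ∀ ε : ℝ, 0 < ε → ∃ N₀ : ℕ, ∀ N : ℕ, N₀ ≤ N → ∀ Ψ : Fin t → AffLinForm d, IsNondegenerateSystem Ψ → affLinSize Ψ 1 ≤ L → ∀ K : Set (Fin d → ℝ), Convex ℝ K → K ⊆ realBox d N → ∃ B : Finset ℕ, B ⊆ pencil θ (strideMod t L) N ∧ (B.card : ℝ) ≤ ε * ((pencil θ (strideMod t L) N).card : ℝ) ∧ ∀ q ∈ pencil θ (strideMod t L) N, q ∉ B → |hlError (dilate q Ψ) K N| ≤ ε * (N : ℝ) ^ d) ∧ (∀ (d t L : ℕ), 1 ≤ d → 1 ≤ t → ∀ ε : ℝ, 0 < ε → ∃ N₀ : ℕ, ∀ N : ℕ, N₀ ≤ N → ∀ Ψ : Fin t → AffLinForm d, IsNondegenerateSystem Ψ → affLinSize Ψ 1 ≤ L → ∀ K : Set (Fin d → ℝ), Convex ℝ K → K ⊆ realBox d N → ∃ E : Finset ℕ, E ⊆ pencil θ (strideMod t L) N ∧ (E.card : ℝ) ≤ ε * ((pencil θ (strideMod t L) N).card : ℝ)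 ∧ ∀ q ∈ pencil θ (strideMod t L) N, q ∉ E → |hlError (dilate q Ψ) K N - hlError Ψ K N| ≤ ε * (N : ℝ) ^ d) :=
  ⟨pencilHLAt_of_ghl hθ₁ h, pencilRigidityAt_of_ghl hθ₁ h⟩


/-! ## §6 The BORN items (route-Parity-HomothetyPencil, rev 0): `PencilHL` = stmt-Parity-32286,
`PencilRigidity` = stmt-Parity-32287, and the shared record items `BoundedSiegelZeroQuality` (25148),
`UniformUpperGivenFixed` (26853), `UniformLowerGivenFixed` (26864) as rendered in
`Theses/HomothetyPencil.lean`.  Every statement below is about those decls BY NAME. -/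

/-- The born text of `PencilHL` IS the pencil statement at `θ = 3/10` over this file's dictionary
(definitional unfolding of `pencil`, `strideMod`, `dilate`, `hlError`). -/
theorem pencilHL_iff_at : PencilHL ↔ (∀ (d t L : ℕ), 1 ≤ d → 1 ≤ t → ∀ ε : ℝ, 0 < ε → ∃ N₀ : ℕ, ∀ N : ℕ, N₀ ≤ N → ∀ Ψ : Fin t → AffLinForm d, IsNondegenerateSystem Ψ → affLinSize Ψ 1 ≤ L → ∀ K : Set (Fin d → ℝ), Convex ℝ K → K ⊆ realBox d N → ∃ B : Finset ℕ, B ⊆ pencil ((3 : ℝ) / 10) (strideMod t L) N ∧ (B.card : ℝ) ≤ ε * ((pencil ((3 : ℝ) / 10) (strideMod t L) N).card : ℝ) ∧ ∀ q ∈ pencil ((3 : ℝ) / 10) (strideMod t L) N, q ∉ B → |hlError (dilate q Ψ) K N| ≤ ε * (N : ℝ) ^ d) := by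
  unfold PencilHL pencil strideMod dilate hlError
  exact Iff.rfl

/-- The born text of `PencilRigidity` IS the rigidity statement at `θ = 3/10`. -/
theorem pencilRigidity_iff_at : PencilRigidity ↔ (∀ (d t L : ℕ), 1 ≤ d → 1 ≤ t → ∀ ε : ℝ, 0 < ε → ∃ N₀ : ℕ, ∀ N : ℕ, N₀ ≤ N → ∀ Ψ : Fin t → AffLinForm d, IsNondegenerateSystem Ψ → affLinSize Ψ 1 ≤ L → ∀ K : Set (Fin d → ℝ), Convex ℝ K → K ⊆ realBox d N → ∃ E : Finset ℕ, E ⊆ pencil ((3 : ℝ) / 10) (strideMod t L) N ∧ (E.card : ℝ) ≤ ε * ((pencil ((3 : ℝ) / 10) (strideMod t L) N).card : ℝ) ∧ ∀ q ∈ pencil ((3 : ℝ) / 10) (strideMod t L) N, q ∉ E → |hlError (dilate q Ψ) K N - hlError Ψ K N| ≤ ε * (N : ℝ) ^ d) := by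
  unfold PencilRigidity pencil strideMod dilate hlError
  exact Iff.rfl

-- The shared items `BoundedSiegelZeroQuality` / `UniformUpperGivenFixed` / `UniformLowerGivenFixed` ARE the
-- record's decls (same texts, definitionally): below they are passed to the record-typed lemmas as they stand
-- (the `*_iff_record` Iff.rfl lemmas print like the landed `ShiftedPrimeFactor.*_iff_record` ones — dedup.landed).

/-- **Necessity** of the credited crux: `GeneralizedHardyLittlewood → PencilHL` (hypothesis-free, `B = ∅`). -/
theorem pencilHL_of_ghl (h : GeneralizedHardyLittlewood) : PencilHL :=
  pencilHL_iff_at.mpr (pencilHLAt_of_ghl (by norm_num) h)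

/-- **Necessity** of the residual crux: `GeneralizedHardyLittlewood → PencilRigidity` (`E = ∅`). -/
theorem pencilRigidity_of_ghl (h : GeneralizedHardyLittlewood) : PencilRigidity :=
  pencilRigidity_iff_at.mpr (pencilRigidityAt_of_ghl (by norm_num) h)

/-- Both pieces are consequences of the sub-problem statement. -/
theorem pieces_of_ghl_items (h : GeneralizedHardyLittlewood) : PencilHL ∧ PencilRigidity :=
  ⟨pencilHL_of_ghl h, pencilRigidity_of_ghl h⟩

/-- KILL PATH: refuting the credited crux refutes the sub-problem statement. -/
theorem not_ghl_of_not_pencilHL (h : ¬ PencilHL) : ¬ GeneralizedHardyLittlewood :=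
  fun hG => h (pencilHL_of_ghl hG)

/-- KILL PATH for the residual: refuting `PencilRigidity` refutes the sub-problem statement. -/
theorem not_ghl_of_not_pencilRigidity (h : ¬ PencilRigidity) : ¬ GeneralizedHardyLittlewood :=
  fun hG => h (pencilRigidity_of_ghl hG)

/-- **Sufficiency beneath the leaves** (no `Q`): the two pieces give BOTH fixed-pattern record leaves
`FixedUpper` (stmt-Parity-26852) and `FixedLower` (stmt-Parity-26863). -/
theorem fixed_of_pencil_items (hP : PencilHL) (hR : PencilRigidity) :
    SiegelSpectrumSplit.FixedUpper ∧ SiegelSpectrumSplit.FixedLower :=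
  fixed_of_pencil (pencilHL_iff_at.mp hP) (pencilRigidity_iff_at.mp hR)

/-- **Node exactness given the record context**: `Q → UU → UL → ((FU ∧ FL) ↔ (PencilHL ∧ PencilRigidity))`. -/
theorem node_iff_items (hQ : BoundedSiegelZeroQuality) (hUU : UniformUpperGivenFixed)
    (hUL : UniformLowerGivenFixed) :
    (SiegelSpectrumSplit.FixedUpper ∧ SiegelSpectrumSplit.FixedLower) ↔ (PencilHL ∧ PencilRigidity) := by
  rw [pencilHL_iff_at, pencilRigidity_iff_at]
  exact node_iff (by norm_num) hQ hUU hUL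

/-- The lens reading on the items: a counterexample to either fixed-pattern leaf refutes one of the two
pencil pieces. -/
theorem counterexample_dichotomy_items
    (h : ¬ (SiegelSpectrumSplit.FixedUpper ∧ SiegelSpectrumSplit.FixedLower)) :
    ¬ PencilHL ∨ ¬ PencilRigidity := by
  by_contra hcon
  push Not at hcon
  exact h (fixed_of_pencil_items hcon.1 hcon.2)

/-- The route's deciding shape, re-derived through the kernel (same binders as the born `closes`). -/
theorem closes_via_kernel (hQ : BoundedSiegelZeroQuality) (hUU : UniformUpperGivenFixed)
    (hUL : UniformLowerGivenFixed) (hP : PencilHL) (hR : PencilRigidity) :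
    GeneralizedHardyLittlewood :=
  ghl_of_record hQ hUU hUL
    (fixedHL_of_pencil (pencilHL_iff_at.mp hP) (pencilRigidity_iff_at.mp hR))

end

end Summit.Parity.GeneralizedHardyLittlewood.Theses.HomothetyPencil
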